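import Summits.AtomisticToContinuum.Crystallization.Theorems.ExcessDecayLiouvilleHcpLiouvilleBlowdownGalerkinRows
import Summits.AtomisticToContinuum.Crystallization.Theorems.ExcessDecayLiouvilleHcpLiouvilleBlowdownGalerkinLinear
import Summits.AtomisticToContinuum.Crystallization.Theorems.ExcessDecayLiouvilleHcpLiouvilleBlowdownCapacity

/-!
# `ExcessDecayLiouville.HcpLiouville` (stmt-AtomisticToContinuum-9332), line `Sketch` v4: the solution operator `𝒢`

Sub-goal `blowdown_greenSolve` (H2 of stub `stub_green`) of crux stmt-AtomisticToContinuum-9332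
(`Summit.AtomisticToContinuum.Crystallization.Theses.ExcessDecayLiouville.HcpLiouville`), line `Sketch`, skeleton
v4: the infinite-volume solution operator `𝒢` of the force-constant operator `L` of the sites of an admissible
hcp-like datum satisfying `PSIneq κ`, on right-hand sides `f` that are bounded functionals of the energy norm
(`|Σ'⟪f, w⟫| ≤ N √(nnForm w)` on finitely supported `w`), as the POINTWISE LIMIT of the Galerkin solutions along the
net of finite sets of sites (files `…BlowdownGalerkin`, `…GalerkinEnergy`, `…GalerkinLimit`, `…GalerkinRows`,
`…GalerkinLinear`; the capacity inequality `blowdown_capacity` makes the net Cauchy), with its API: (i) rows,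
(ii) pointwise bound, (iii) energy bound, (iv) translation differences, (v)/(vii) linearity, (vi) lattice covariance,
(viii) countable additivity, (ix) self-reproduction.  One universal constant `C = max (√(max C_cap 0)) 2`.
All `[folklore]`; a `--supports` file, nothing here closes an item.
-/

noncomputable section

namespace Summit.AtomisticToContinuum.Crystallization.Theorems.ExcessDecayLiouville

open scoped BigOperators Topology Classical InnerProductSpace RealInnerProductSpace
open Filter
open Literature.MathematicalPhysics.StatisticalMechanics
open Summit.AtomisticToContinuum.Crystallization.Theses.ExcessDecayLiouville
open Summit.AtomisticToContinuum.Crystallization.Theorems.PhononStabilityNegative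

/-- **The solution operator of the force-constant operator by exhaustion** (sub-goal `blowdown_greenSolve`, H2 of
stub `stub_green`, crux stmt-AtomisticToContinuum-9332, line `Sketch` v4): Galerkin limits along the net of finite
sets of sites, with the API (i)–(ix) described in the module docstring. [folklore] -/
theorem blowdown_greenSolve : ∃ C : ℝ, ∀ (κ : ℝ) (t : Fin 2 → (EuclideanSpace ℝ (Fin 3))) (A : (EuclideanSpace ℝ (Fin 3)) →L[ℝ] (EuclideanSpace ℝ (Fin 3))), 0 < κ → Adm₀ A → Inner₀ t A → Blowdown.PSIneq κ t A → ∃ 𝒢 : ((EuclideanSpace ℝ (Fin 3)) → (EuclideanSpace ℝ (Fin 3))) → ((EuclideanSpace ℝ (Fin 3)) → (EuclideanSpace ℝ (Fin 3))), (∀ (f : (EuclideanSpace ℝ (Fin 3)) → (EuclideanSpace ℝ (Fin 3))) (N : ℝ), 0 ≤ N → (∀ w : (EuclideanSpace ℝ (Fin 3)) → (EuclideanSpace ℝ (Fin 3)), (Function.support w).Finite → Function.support w ⊆ Sites₀ t A → |∑' p : Sites₀ t A, ⟪f p, w p⟫| ≤ N * Real.sqrt (nnForm t A w)) → (∀ p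 : Sites₀ t A, HasSum (fun q : Sites₀ t A => forceConst ((p : (EuclideanSpace ℝ (Fin 3))) - q) (𝒢 f p - 𝒢 f q)) (f p)) ∧ (∀ p ∈ Sites₀ t A, ‖𝒢 f p‖ ≤ C / κ * N) ∧ Summable (fun pq : Sites₀ t A × Sites₀ t A => if dist (pq.1 : (EuclideanSpace ℝ (Fin 3))) pq.2 ≤ 11 / 10 then ‖𝒢 f pq.1 - 𝒢 f pq.2‖ ^ 2 else 0) ∧ nnForm t A (𝒢 f) ≤ (C / κ * N) ^ 2 ∧ (∀ e ∈ ({triangularVec₁ 1, triangularVec₂ 1, layerNormal (2 * Real.sqrt (2 / 3))} : Finset (EuclideanSpace ℝ (Fin 3))), Summable (fun p : Sites₀ t A => ‖𝒢 f (p + A e) - 𝒢 f p‖ ^ 2) ∧ ∑' p : Sites₀ t A, ‖𝒢 f (p + A e) - 𝒢 f p‖ ^ 2 ≤ (C / κ * N) ^ 2) ∧ (∀ c : ℝ, ∀ p ∈ Sites₀ t A, 𝒢 (c • f) p = c • 𝒢 f p) ∧ (∀ e ∈ Λ₀, (∀ w : (EuclideanSpace ℝ (Fin 3)) → (EuclideanSpace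 ℝ (Fin 3)), (Function.support w).Finite → Function.support w ⊆ Sites₀ t A → |∑' p : Sites₀ t A, ⟪f (p - A e), w p⟫| ≤ N * Real.sqrt (nnForm t A w)) → ∀ p ∈ Sites₀ t A, 𝒢 (fun x => f (x - A e)) p = 𝒢 f (p - A e))) ∧ (∀ (f g : (EuclideanSpace ℝ (Fin 3)) → (EuclideanSpace ℝ (Fin 3))) (Nf Ng : ℝ), 0 ≤ Nf → 0 ≤ Ng → (∀ w : (EuclideanSpace ℝ (Fin 3)) → (EuclideanSpace ℝ (Fin 3)), (Function.support w).Finite → Function.support w ⊆ Sites₀ t A → |∑' p : Sites₀ t A, ⟪f p, w p⟫| ≤ Nf * Real.sqrt (nnForm t A w)) → (∀ w : (EuclideanSpace ℝ (Fin 3)) → (EuclideanSpace ℝ (Fin 3)), (Function.support w).Finite → Function.support w ⊆ Sites₀ t A → |∑' p : Sites₀ t A, ⟪g p, w p⟫| ≤ Ng * Real.sqrt (nnForm t A w)) → ∀ p ∈ Sites₀ t A, 𝒢 (f + g) p = 𝒢 f p + 𝒢 g p) ∧ (∀ (ι : Type) (F : ι → (EuclideanSpace ℝ (Fin 3)) →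 (EuclideanSpace ℝ (Fin 3))) (Nn : ι → ℝ) (f : (EuclideanSpace ℝ (Fin 3)) → (EuclideanSpace ℝ (Fin 3))), (∀ n, 0 ≤ Nn n) → Summable Nn → (∀ n, ∀ w : (EuclideanSpace ℝ (Fin 3)) → (EuclideanSpace ℝ (Fin 3)), (Function.support w).Finite → Function.support w ⊆ Sites₀ t A → |∑' p : Sites₀ t A, ⟪F n p, w p⟫| ≤ Nn n * Real.sqrt (nnForm t A w)) → (∀ p ∈ Sites₀ t A, HasSum (fun n => F n p) (f p)) → ∀ p ∈ Sites₀ t A, HasSum (fun n => 𝒢 (F n) p) (𝒢 f p)) ∧ (∀ φ : (EuclideanSpace ℝ (Fin 3)) → (EuclideanSpace ℝ (Fin 3)), (Function.support φ).Finite → Function.support φ ⊆ Sites₀ t A → ∀ (g : (EuclideanSpace ℝ (Fin 3)) → (EuclideanSpace ℝ (Fin 3))) (N : ℝ), 0 ≤ N → (∀ p : Sites₀ t A, HasSum (fun q : Sites₀ t A => forceConst ((p : (EuclideanSpace ℝ (Fin 3))) - q) (φ p - φ q)) (g p)) → (∀ w : (EuclideanSpace ℝ (Fin 3)) → (EuclideanSpace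 ℝ (Fin 3)), (Function.support w).Finite → Function.support w ⊆ Sites₀ t A → |∑' p : Sites₀ t A, ⟪g p, w p⟫| ≤ N * Real.sqrt (nnForm t A w)) → ∀ p ∈ Sites₀ t A, 𝒢 g p = φ p) := by
  obtain ⟨C₀, hC₀⟩ := blowdown_capacity
  refine ⟨max (Real.sqrt (max C₀ 0)) 2, fun κ t A hκ hA hI hPS => ?_⟩
  -- the capacity inequality at this datum, with a nonnegative constant
  set C : ℝ := max C₀ 0 with hCdef
  have hC : 0 ≤ C := le_max_right _ _
  have hcap : ∀ w : (EuclideanSpace ℝ (Fin 3)) → (EuclideanSpace ℝ (Fin 3)), (Function.support w).Finite →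
      Function.support w ⊆ Sites₀ t A → ∀ p ∈ Sites₀ t A, ‖w p‖ ^ 2 ≤ C * nnForm t A w :=
    fun w hw hwS p hp => (hC₀ t A hA hI w hw hwS p hp).trans
      (mul_le_mul_of_nonneg_right (le_max_left _ _) (nnForm_nonneg _ _ _))
  -- constants
  set C' : ℝ := max (Real.sqrt C) 2 with hC'def
  have hC'1 : 1 ≤ C' := le_trans (by norm_num) (le_max_right _ _)
  have hC'2 : 2 ≤ C' := le_max_right _ _
  have hC'0 : 0 ≤ C' := le_trans (by norm_num) hC'2
  -- the Galerkin family
  have hex : ∀ (V : Finset (Sites₀ t A)) (f : (EuclideanSpace ℝ (Fin 3)) → (EuclideanSpace ℝ (Fin 3))),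
      ∃ u : (EuclideanSpace ℝ (Fin 3)) → (EuclideanSpace ℝ (Fin 3)),
        Function.support u ⊆ Subtype.val '' (V : Set (Sites₀ t A)) ∧
        ∀ p : Sites₀ t A, p ∈ V →
          ∑' q : Sites₀ t A, forceConst ((p : EuclideanSpace ℝ (Fin 3)) - q) (u p - u q) = f p :=
    fun V f => exists_galerkin hA hI hκ hPS V f
  choose U hU using hex
  -- the operator: pointwise limits along the net of finite sets of sites
  obtain ⟨𝒢, h𝒢⟩ : ∃ 𝒢 : ((EuclideanSpace ℝ (Fin 3)) → (EuclideanSpace ℝ (Fin 3))) →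
      (EuclideanSpace ℝ (Fin 3)) → (EuclideanSpace ℝ (Fin 3)),
      ∀ (f : (EuclideanSpace ℝ (Fin 3)) → (EuclideanSpace ℝ (Fin 3))) (x : EuclideanSpace ℝ (Fin 3)),
        𝒢 f x = limUnder atTop (fun V : Finset (Sites₀ t A) => U V f x) :=
    ⟨fun f x => limUnder atTop (fun V : Finset (Sites₀ t A) => U V f x), fun f x => rfl⟩
  -- limits exist for admissible right-hand sides
  have key : ∀ (f : (EuclideanSpace ℝ (Fin 3)) → (EuclideanSpace ℝ (Fin 3))) (N : ℝ), 0 ≤ N →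
      (∀ w : (EuclideanSpace ℝ (Fin 3)) → (EuclideanSpace ℝ (Fin 3)), (Function.support w).Finite →
        Function.support w ⊆ Sites₀ t A → |∑' p : Sites₀ t A, ⟪f p, w p⟫| ≤ N * Real.sqrt (nnForm t A w)) →
      ∀ p : Sites₀ t A, Tendsto (fun V : Finset (Sites₀ t A) => U V f p) atTop (𝓝 (𝒢 f p)) := by
    intro f N hN hf p
    obtain ⟨g, hg⟩ := exists_tendsto_galerkin hA hI hκ hPS hN hf (fun V => hU V f) hC hcap p
    rw [h𝒢 f p, hg.limUnder_eq]
    exact hg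
  have hNκ : ∀ {N : ℝ}, 0 ≤ N → (N / κ) ^ 2 ≤ (C' / κ * N) ^ 2 := by
    intro N hN
    have h0 : 0 ≤ N / κ := div_nonneg hN hκ.le
    have h1 : N / κ ≤ C' / κ * N := by
      rw [show C' / κ * N = C' * (N / κ) by ring]
      exact le_mul_of_one_le_left h0 hC'1
    exact pow_le_pow_left₀ h0 h1 2
  refine ⟨𝒢, ?_, ?_, ?_, ?_⟩
  · -- clauses (i)–(vi) for an admissible right-hand side `(f, N)`
    intro f N hN hf
    have hG := key f N hN hf
    refine ⟨fun p => hasSum_row_lim hA hI hκ hPS hN hf (fun V => hU V f) hG p, ?_, ?_, ?_, ?_, ?_, ?_⟩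
    · -- (ii)
      intro p hp
      have h := norm_lim_le hA hI hκ hPS hN hf (fun V => hU V f) hC hcap hG ⟨p, hp⟩
      calc ‖𝒢 f p‖ ≤ Real.sqrt C * (N / κ) := h
        _ ≤ C' * (N / κ) := mul_le_mul_of_nonneg_right (le_max_left _ _) (div_nonneg hN hκ.le)
        _ = C' / κ * N := by ring
    · -- (iii), summability
      exact (nnPair_lim hA hI hκ hPS hN hf (fun V => hU V f) hG).1
    · -- (iii), bound
      exact (nnPair_lim hA hI hκ hPS hN hf (fun V => hU V f) hG).2.2.trans (hNκ hN)
    · -- (iv)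
      intro e he
      obtain ⟨hs, hb⟩ := translate_sq_lim hA hI hκ hPS hN hf (fun V => hU V f) hG he
      refine ⟨hs, hb.trans ?_⟩
      have h0 : 0 ≤ (N / κ) ^ 2 := sq_nonneg _
      have h4 : (4 : ℝ) ≤ C' ^ 2 := by nlinarith
      calc 4 * (N / κ) ^ 2 ≤ C' ^ 2 * (N / κ) ^ 2 := mul_le_mul_of_nonneg_right h4 h0
        _ = (C' / κ * N) ^ 2 := by ring
    · -- (v)
      intro c p hp
      have hG' := key (c • f) (|c| * N) (by positivity) (Blowdown.adm_smul c hf)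
      exact lim_smul hA hI hκ hPS c (fun V => hU V f) (fun V => hU V (c • f)) hG hG' ⟨p, hp⟩
    · -- (vi)
      intro e he hfe p hp
      have hG' := key (fun x => f (x - A e)) N hN hfe
      exact lim_translate hA hI hκ hPS he (fun V => hU V f) (fun V => hU V (fun x => f (x - A e))) hG hG' ⟨p, hp⟩
  · -- (vii)
    intro f g Nf Ng hNf hNg hf hg p hp
    exact lim_add hA hI hκ hPS (fun V => hU V f) (fun V => hU V g) (fun V => hU V (f + g))
      (key f Nf hNf hf) (key g Ng hNg hg) (key (f + g) (Nf + Ng) (by positivity) (Blowdown.adm_add hf hg)) ⟨p, hp⟩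
  · -- (viii)
    intro ι F Nn f hNn hsNn hF hsum p hp
    have hf := adm_of_hasSum (t := t) (A := A) hsNn hF (fun q => hsum q q.2)
    exact hasSum_lim hA hI hκ hPS hNn hsNn hF (fun n V => hU V (F n)) (fun V => hU V f) hC hcap
      (fun n => key (F n) (Nn n) (hNn n) (hF n)) (key f _ (tsum_nonneg hNn) hf) (fun q => hsum q q.2) ⟨p, hp⟩
  · -- (ix)
    intro φ hφ hφS g N hN hg hgadm p hp
    exact lim_eq_of_finite hA hI hκ hPS hφ hφS hg (fun V => hU V g) (key g N hN hgadm) ⟨p, hp⟩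

end Summit.AtomisticToContinuum.Crystallization.Theorems.ExcessDecayLiouville

end
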